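import Summits.KontsevichZagierPeriods.KontsevichZagierPeriods.Theses.LinRedNormalForm
import Literature.Barriers.KontsevichZagierPeriods.AlgebraicPrimitivesObstruction

/-!
# `DihedralNormalForm` (stmt-KontsevichZagierPeriods-3912): negative side — no linear combination of algebraic functions is a primitive of a simple pole

Landed copy of §7 of the crux work file `Cruxes/DihedralNormalForm/Disproof.lean` (cdisprove seat,
generation 3): the ELIMINATION STEP of the proof that rule (2) (change of variables) is
load-bearing for the crux `DihedralNormalForm` (work file §5).  There, after pushing a putative
change-of-variables-free move chain forward to two coordinates and eliminating the MZV-word side by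
its `1/x₀`-homogeneity, one is left with an identity `G' = c/(1-x₁)` on an interval, where `G` is an
`ℝ`-linear combination of slices `x₁ ↦ Fⱼ(r_k, x₁)` of the `ℚ`-semialgebraic primitives of finitely
many Newton–Leibniz moves — each slice satisfying a non-trivial REAL polynomial relation.  This file
proves that such an identity is impossible, generalising the one-function barrier
`Literature.Barriers.KontsevichZagierPeriods.AlgebraicPrimitivesObstruction` (steps (C)–(D)) in two
directions:

* `eq_zero_of_evalEval_eq_zero_Ioo` — the simple-pole descent of the barrier file
  (`NoSemialgPrimKernel.eq_zero_of_evalEval_eq_zero`, stated there on `(0,1)`) transported to an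
  arbitrary open interval `(u,v)` by the affine substitution `t = u + (v-u)s` (coefficientwise
  `Polynomial.comp`, injective);
* `exists_monic_evalEval_eq_zero` — if each `φᵢ` satisfies `Pᵢ(t, φᵢ t) = 0` on a set `J`
  (`Pᵢ ∈ ℝ[X][Y]` arbitrary, possibly zero), then `(∏ᵢ lead Pᵢ)(t) · Σ λᵢ φᵢ(t)` satisfies a MONIC
  polynomial relation on `J`: integrality of `lead(Pᵢ)·φᵢ` over `ℝ[t]` in the ring of real functions
  on `J` (`RingHom.isIntegralElem_leadingCoeff_mul`) and closure of integral elements under sums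
  and products — no continuity, analyticity or resultants needed;
* `no_linearCombination_algebraic_primitive` — hence no `G = Σ λᵢ φᵢ` with the `Pᵢ ≠ 0` has
  derivative `N/((X − x₀)V)`, `V(x₀)N(x₀) ≠ 0`, on `(u,v)`; `…_letter`: in particular not `c/(1-t)`
  or `c/t`, `c ≠ 0` (the two MZV letters).

[Ayoub 2015, Rem. 1.2 (primitives of algebraic functions are transcendental); Kontsevich–Zagier
2001, §1.2 rule (3)] -/

noncomputable section

open Set Polynomial
open scoped Polynomial.Bivariate

namespace Summit.KontsevichZagierPeriods.DihedralNormalForm.Negative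

/-! ### (A) bivariate evaluation in the ring of functions on a set -/

/-- The ring of real functions on `J` as an algebra over `ℝ[X]` through evaluation. -/
def evalFun (J : Set ℝ) : ℝ[X] →+* (J → ℝ) :=
  RingHom.pi fun t : J => Polynomial.evalRingHom (t : ℝ)

/-- Evaluation of `evalFun`. [folklore] -/
@[simp] theorem evalFun_apply (J : Set ℝ) (p : ℝ[X]) (t : J) : evalFun J p t = p.eval (t : ℝ) := rfl

/-- `eval₂` into the function ring is pointwise bivariate evaluation. [folklore] -/
theorem eval₂_evalFun_apply (J : Set ℝ) (P : ℝ[X][Y]) (x : J → ℝ) (t : J) :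
    (P.eval₂ (evalFun J) x) t = P.evalEval (t : ℝ) (x t) := by
  induction P using Polynomial.induction_on' with
  | add p q hp hq => simp [eval₂_add, evalEval_add, hp, hq]
  | monomial n a =>
    simp [eval₂_monomial, evalEval, eval_monomial]

/-! ### (B) integrality of linear combinations -/

/-- If each `φᵢ` satisfies a non-trivial polynomial relation `Pᵢ(t, φᵢ t) = 0` on `J`, then
`a(t) · Σ λᵢ φᵢ(t)`, `a = ∏ᵢ lead(Pᵢ)`, satisfies a MONIC polynomial relation on `J` (integrality of
`lead(Pᵢ)·φᵢ` over `ℝ[t]` in the ring of functions on `J`, and closure of integral elements under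
ring operations). [folklore] -/
theorem exists_monic_evalEval_eq_zero {ι : Type*} [Fintype ι] [DecidableEq ι] {J : Set ℝ}
    (φ : ι → ℝ → ℝ) (P : ι → ℝ[X][Y])
    (hrel : ∀ i, ∀ t ∈ J, (P i).evalEval t (φ i t) = 0) (lam : ι → ℝ) :
    ∃ Q : ℝ[X][Y], Q.Monic ∧ ∀ t ∈ J,
      Q.evalEval t ((∏ i, ((P i).leadingCoeff).eval t) * ∑ i, lam i * φ i t) = 0 := by
  set f := evalFun J with hf
  let x : ι → J → ℝ := fun i t => φ i t
  have hx : ∀ i, (P i).eval₂ f (x i) = 0 := by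
    intro i
    funext t
    rw [eval₂_evalFun_apply]
    exact hrel i t t.2
  have hint : ∀ i, f.IsIntegralElem (f (P i).leadingCoeff * x i) := fun i =>
    f.isIntegralElem_leadingCoeff_mul (P i) (x i) (hx i)
  -- the combination, written inside the integral closure
  set H : J → ℝ := ∑ i, f (C (lam i) * ∏ i' ∈ Finset.univ.erase i, (P i').leadingCoeff) *
    (f (P i).leadingCoeff * x i) with hH
  have hHint : f.IsIntegralElem H := by
    rw [hH]
    refine Finset.sum_induction _ (fun y => f.IsIntegralElem y)
      (fun a b ha hb => RingHom.IsIntegralElem.add f ha hb) ?_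
      (fun i _ => RingHom.IsIntegralElem.mul f f.isIntegralElem_map (hint i))
    simpa using f.isIntegralElem_map (x := 0)
  obtain ⟨Q, hQm, hQ⟩ := hHint
  refine ⟨Q, hQm, fun t ht => ?_⟩
  have happ := congrFun hQ ⟨t, ht⟩
  rw [eval₂_evalFun_apply] at happ
  simp only [Pi.zero_apply] at happ
  convert happ using 2
  -- pointwise identity `a(t) Σ λᵢ φᵢ(t) = H t`
  simp only [hH, hf, Finset.sum_apply, Pi.mul_apply, evalFun_apply, eval_mul, eval_C, eval_prod, x,
    Finset.mul_sum]
  refine Finset.sum_congr rfl fun i _ => ?_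
  rw [← Finset.prod_erase_mul _ _ (Finset.mem_univ i)]
  ring

/-! ### (C) the simple-pole descent on an arbitrary open interval -/

/-- Coefficientwise composition commutes with bivariate evaluation. [folklore] -/
theorem evalEval_map_compRingHom (P : ℝ[X][Y]) (q : ℝ[X]) (s y : ℝ) :
    (P.map q.compRingHom).evalEval s y = P.evalEval (q.eval s) y := by
  induction P using Polynomial.induction_on' with
  | add p r hp hr => simp [Polynomial.map_add, evalEval_add, hp, hr]
  | monomial n a =>
    simp [Polynomial.map_monomial, evalEval, eval_monomial, eval_comp]

/-- **Step (C) of the barrier on an arbitrary interval** (transport by an affine substitution): a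
function whose derivative on `(u, v)` is `N/((X − x₀) V)` with `V(x₀) N(x₀) ≠ 0` satisfies no
non-trivial polynomial relation `P(t, G t) = 0` on `(u, v)`. [folklore] -/
theorem eq_zero_of_evalEval_eq_zero_Ioo {u v : ℝ} (huv : u < v) {G g' : ℝ → ℝ} {V N : ℝ[X]}
    {x₀ : ℝ} (hG : ∀ t ∈ Ioo u v, HasDerivAt G (g' t) t)
    (hDN : ∀ t ∈ Ioo u v, ((X - C x₀) * V).eval t * g' t = N.eval t)
    (hV : V.eval x₀ ≠ 0) (hN : N.eval x₀ ≠ 0) (P : ℝ[X][Y])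
    (hv : ∀ t ∈ Ioo u v, P.evalEval t (G t) = 0) : P = 0 := by
  have hw : v - u ≠ 0 := by linarith
  have hw0 : 0 < v - u := by linarith
  set q : ℝ[X] := C u + C (v - u) * X with hq
  have hqe : ∀ s, q.eval s = u + (v - u) * s := fun s => by simp [hq]
  have hφ : ∀ s ∈ Ioo (0 : ℝ) 1, q.eval s ∈ Ioo u v := by
    intro s hs
    rw [hqe]
    constructor <;> nlinarith [hs.1, hs.2]
  set x₁ : ℝ := (x₀ - u) / (v - u) with hx₁
  have hqx₁ : q.eval x₁ = x₀ := by
    rw [hqe, hx₁]; field_simp; ring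
  have hG' : ∀ s ∈ Ioo (0 : ℝ) 1,
      HasDerivAt (fun s => G (q.eval s)) ((v - u) * g' (q.eval s)) s := by
    intro s hs
    have h1 : HasDerivAt (fun s : ℝ => u + (v - u) * s) (v - u) s := by
      simpa using ((hasDerivAt_id s).const_mul (v - u)).const_add u
    have h2 := (hG _ (hφ s hs)).comp s (h1.congr_of_eventuallyEq
      (Filter.Eventually.of_forall fun s => (hqe s)))
    simpa [mul_comm, Function.comp_def, hqe] using h2
  have hDN' : ∀ s ∈ Ioo (0 : ℝ) 1,
      ((X - C x₁) * V.comp q).eval s * ((v - u) * g' (q.eval s)) = (N.comp q).eval s := by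
    intro s hs
    have h := hDN _ (hφ s hs)
    simp only [eval_mul, eval_sub, eval_X, eval_C, eval_comp] at h ⊢
    have e : (s - x₁) * (v - u) = q.eval s - x₀ := by
      rw [hqe, hx₁]; field_simp; ring
    calc (s - x₁) * V.eval (q.eval s) * ((v - u) * g' (q.eval s))
        = ((s - x₁) * (v - u)) * V.eval (q.eval s) * g' (q.eval s) := by ring
      _ = N.eval (q.eval s) := by rw [e]; exact h
  have hV' : (V.comp q).eval x₁ ≠ 0 := by rwa [eval_comp, hqx₁]
  have hN' : (N.comp q).eval x₁ ≠ 0 := by rwa [eval_comp, hqx₁]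
  have key := Literature.Barriers.KontsevichZagierPeriods.KZ.NoSemialgPrimKernel.eq_zero_of_evalEval_eq_zero
    (G := fun s => G (q.eval s)) hG' hDN' hV' hN' _ (P.map q.compRingHom) le_rfl
    (fun s hs => by rw [evalEval_map_compRingHom]; exact hv _ (hφ s hs))
  have hinj : Function.Injective (q.compRingHom : ℝ[X] → ℝ[X]) := by
    intro a b hab
    have h0 : (a - b).comp q = 0 := by
      have : a.comp q = b.comp q := hab
      rw [sub_comp, this, sub_self]
    rcases (comp_eq_zero_iff.1 h0) with h | ⟨-, h⟩
    · exact sub_eq_zero.1 h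
    · exfalso
      have := congrArg (Polynomial.coeff · 1) h
      simp [hq, coeff_C, coeff_X] at this
      exact hw this
  exact Polynomial.map_injective _ hinj (key.trans (Polynomial.map_zero _).symm)

/-! ### (D) the combination lemma -/

/-- **No `ℝ`-linear combination of pointwise-algebraic functions is a primitive of a simple pole.**
If `G = Σ λᵢ φᵢ` on `(u,v)` with each `φᵢ` satisfying a non-trivial polynomial relation there, then
`G' = N/((X − x₀)V)` with `V(x₀)N(x₀) ≠ 0` is impossible.  (Elimination step of the rule-(2)
analysis of crux `DihedralNormalForm`, work file §5; generalises the one-function barrier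
`AlgebraicPrimitivesObstruction`.) [folklore] -/
theorem no_linearCombination_algebraic_primitive {ι : Type*} [Fintype ι] [DecidableEq ι]
    {u v : ℝ} (huv : u < v) (φ : ι → ℝ → ℝ) (P : ι → ℝ[X][Y]) (hP0 : ∀ i, P i ≠ 0)
    (hrel : ∀ i, ∀ t ∈ Ioo u v, (P i).evalEval t (φ i t) = 0) (lam : ι → ℝ)
    {G g' : ℝ → ℝ} (hGsum : ∀ t ∈ Ioo u v, G t = ∑ i, lam i * φ i t)
    (hG : ∀ t ∈ Ioo u v, HasDerivAt G (g' t) t) {V N : ℝ[X]} {x₀ : ℝ}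
    (hDN : ∀ t ∈ Ioo u v, ((X - C x₀) * V).eval t * g' t = N.eval t)
    (hV : V.eval x₀ ≠ 0) (hN : N.eval x₀ ≠ 0) : False := by
  obtain ⟨Q, hQm, hQ⟩ := exists_monic_evalEval_eq_zero φ P hrel lam
  set a : ℝ[X] := ∏ i, (P i).leadingCoeff with ha
  have ha0 : a ≠ 0 := Finset.prod_ne_zero_iff.2 fun i _ => leadingCoeff_ne_zero.2 (hP0 i)
  have hae : ∀ t, a.eval t = ∏ i, ((P i).leadingCoeff).eval t := fun t => by rw [ha, eval_prod]
  -- `P* (t, Y) := Q(t, a(t) Y)`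
  set d := Q.natDegree with hd
  set Pstar : ℝ[X][Y] := ∑ j ∈ Finset.range (d + 1), C (Q.coeff j * a ^ j) * Y ^ j with hPstar
  have hPstar_eval : ∀ t y, Pstar.evalEval t y = Q.evalEval t (a.eval t * y) := by
    intro t y
    have hQsum : Q = ∑ j ∈ Finset.range (d + 1), C (Q.coeff j) * Y ^ j := Q.as_sum_range_C_mul_X_pow
    conv_rhs => rw [hQsum]
    simp only [hPstar, evalEval_finsetSum, evalEval_mul, evalEval_C, evalEval_pow, evalEval_X,
      eval_mul, eval_pow]
    refine Finset.sum_congr rfl fun j _ => ?_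
    ring
  have hPstar0 : Pstar ≠ 0 := by
    intro h0
    have hc := congrArg (Polynomial.coeff · d) h0
    simp only [hPstar, coeff_zero] at hc
    rw [Literature.Barriers.KontsevichZagierPeriods.KZ.NoSemialgPrim.coeff_sum_C_mul_X_pow] at hc
    simp only [lt_add_iff_pos_right, zero_lt_one, if_true] at hc
    have hlead : Q.coeff d = 1 := hQm
    rw [hlead, one_mul] at hc
    exact pow_ne_zero d ha0 hc
  refine hPstar0 (eq_zero_of_evalEval_eq_zero_Ioo huv hG hDN hV hN Pstar fun t ht => ?_)
  rw [hPstar_eval, hGsum t ht, hae]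
  exact hQ t ht

/-- Corollary for the letters: no `ℝ`-linear combination of pointwise-algebraic functions on an
interval `(u,v)`, `v ≤ 1` (resp. `0 ≤ u`), has derivative `c/(1-t)` (resp. `c/t`), `c ≠ 0`. [folklore] -/
theorem no_linearCombination_algebraic_primitive_letter {ι : Type*} [Fintype ι] [DecidableEq ι]
    (ε : Bool) {u v : ℝ} (huv : u < v) (hside : if ε then v ≤ 1 else 0 ≤ u)
    (φ : ι → ℝ → ℝ) (P : ι → ℝ[X][Y]) (hP0 : ∀ i, P i ≠ 0)
    (hrel : ∀ i, ∀ t ∈ Ioo u v, (P i).evalEval t (φ i t) = 0) (lam : ι → ℝ)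
    {G : ℝ → ℝ} (hGsum : ∀ t ∈ Ioo u v, G t = ∑ i, lam i * φ i t) {c : ℝ} (hc : c ≠ 0)
    (hG : ∀ t ∈ Ioo u v, HasDerivAt G (if ε then c / (1 - t) else c / t) t) : False := by
  let x₀ : ℝ := if ε then 1 else 0
  let V : ℝ[X] := if ε then C (-1) else C 1
  have hV : V.eval x₀ ≠ 0 := by cases ε <;> simp [V, x₀]
  have hN : (C c : ℝ[X]).eval x₀ ≠ 0 := by simpa using hc
  refine no_linearCombination_algebraic_primitive huv φ P hP0 hrel lam hGsum hG
    (V := V) (N := C c) (x₀ := x₀) (fun t ht => ?_) hV hN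
  cases ε
  · simp only [Bool.false_eq_true, if_false] at hside ⊢
    have h0 : t ≠ 0 := by intro h; rw [h] at ht; linarith [ht.1]
    simp only [V, x₀, Bool.false_eq_true, if_false, eval_mul, eval_sub, eval_X, eval_C]
    field_simp
    ring
  · simp only [if_true] at hside ⊢
    have h1 : (1 : ℝ) - t ≠ 0 := by intro h; linarith [ht.2]
    simp only [V, x₀, if_true, eval_mul, eval_sub, eval_X, eval_C]
    field_simp
    ring

end Summit.KontsevichZagierPeriods.DihedralNormalForm.Negative
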